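import Mathlib.CategoryTheory.IsConnected
import Mathlib.CategoryTheory.Skeletal
import Mathlib.CategoryTheory.EssentialImage
import Literature.AlgebraicGeometry.Frobenioids.BaseFrobeniusSections
import HarnessLib

/-!
# Frobenioids I, §2: base-sections and Frobenius-sections — proofs (Def. 2.7, Rmk. 2.7.2)

Mochizuki, *The geometry of Frobenioids I*, Kyushu J. Math. **62** (2008), §2, kurims pp. 51–52
[cite: MochizukiFrdI2008, Def. 2.7 p.51].  Proof-only companion of `BaseFrobeniusSections.lean`
(statements by abc-iut-L1-t2, untouched):

* `EndDegFrIndependent_holds` — Def. 2.7 (ii), preliminary claim: for `ε ∈ End(P ↪ C)` the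
  Frobenius degree of `ε_A` does not depend on `A` "since `P` is connected".  Naturality of `ε`
  and multiplicativity of `deg_Fr` give constancy along every arrow of `P`; `P ≃ D` and `D` is
  connected (standing hypothesis "`C` is a Frobenioid").
* `DistinguishedBothIffId_holds` — Rmk. 2.7.2, first claim: an arrow that is both `P`- and
  `F`-distinguished is an identity (a `P`-distinguished arrow is a pull-back morphism, hence linear;
  `deg_Fr(F(n)_A) = n` forces `n = 1`, and `F(1) = id`).
* `DistinguishedFactorization_holds` — Rmk. 2.7.2, second claim: for `C` base-trivial and a
  skeleton, every arrow factors uniquely (strictly) as `α ∘ β ∘ γ` with `γ` `F`-distinguished, `β` a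
  base-identity pre-step endomorphism, `α` `P`-distinguished (Def. 1.3 (iv)(a), (ii), the pull-back
  property of `α`, total epimorphicity of `C`, `P ⥲ D`).

No new definitions (theorems only).
-/

namespace Literature.AlgebraicGeometry.Frobenioids

open CategoryTheory

universe w v v' u u'

namespace PreFrobenioid

variable {D : Type u} [Category.{v} D] {Φ : Dᵒᵖ ⥤ CommMonCat.{w}}
  {C : Type u'} [Category.{v'} C] (F : C ⥤ ElemFrobenioid Φ)
  (P : Presection C) (Fr : ℕ+ →* End P.ι)

/-! ### Definition 2.7 (ii): the Frobenius degree of `ε ∈ End(P ↪ C)` -/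

/-- For `ε ∈ End(P ↪ C)` and an arrow `f : A → B` of `P`, `deg_Fr(ε_A) = deg_Fr(ε_B)`: apply `deg_Fr`
(multiplicative, Remark 1.1.1) to the naturality square `f ∘ ε_A = ε_B ∘ f` and cancel `deg_Fr(f)`
in `ℕ_{≥1}`. (Primed name: the unprimed `PreFrobenioid.degFr_app_eq_of_hom` is the base-section
variant of `BaseSectionRemarks.lean`; R23 duplicate-FQN repair, L1-lead ruling 2026-08-25T21:19:39Z.)
[cite: MochizukiFrdI2008, Def. 2.7(ii) p.51] -/
theorem degFr_app_eq_of_hom' (ε : End P.ι) {A B : P.Cat} (f : A ⟶ B) :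
    degFr F (ε.app A) = degFr F (ε.app B) := by
  have h := congrArg (degFr F) (ε.naturality f)
  rw [degFr_comp, degFr_comp, mul_comm (degFr F (ε.app A))] at h
  exact (mul_left_cancel h).symm

/-- **Def. 2.7 (ii), preliminary claim, proved**: for a Frobenioid `C`, a base-section `P` and
`ε ∈ End(P ↪ C)`, the Frobenius degree of `ε_A` is
independent of `A ∈ Ob(P)` — "since `P` is connected" (`P → D` is an equivalence and the base
category `D` of a Frobenioid is connected). [cite: MochizukiFrdI2008, Def. 2.7(ii) p.51] -/
theorem EndDegFrIndependent_holds : EndDegFrIndependent F P := by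
  intro hF hP ε A B
  haveI : (P.toBase F).IsEquivalence := hP.isEquivalence
  haveI : IsConnected D :=
    (isGraphConnected_iff_isConnected (C := D)).mp hF.isPreFrobenioid.isGraphConnected_base
  haveI : IsConnected P.Cat := isConnected_of_equivalent (P.toBase F).asEquivalence.symm
  exact constant_of_preserves_morphisms (fun X : P.Cat => degFr F (ε.app X))
    (fun _ _ f => degFr_app_eq_of_hom' F P ε f) A B

/-! ### Remark 2.7.2, first claim -/

/-- **Rmk. 2.7.2, first claim, proved**: for a base-Frobenius pair `(P, F)` the only arrows that are
both `F`- and `P`-distinguished are the identities.  A `P`-distinguished arrow lies in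
`P ⊆ C^pl-bk`, hence is linear (Def. 1.3 (iv)(b)); an `F`-distinguished one is `F(n)_A` of
Frobenius degree `n`; so `n = 1` and the arrow is `F(1)_A = id_A`.  (The hypotheses "`C` of
isotropic type" of the Remark is not needed for this claim.)
[cite: MochizukiFrdI2008, Rem. 2.7.2 p.52] -/
theorem DistinguishedBothIffId_holds : DistinguishedBothIffId F P Fr := by
  intro hF _hiso hpair A φ hP hFd
  obtain ⟨hA, n, hn⟩ := hFd
  have hlin : degFr F φ = 1 := (hF.iv_b φ (hpair.isBaseSection.hom_pullback φ hP)).2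
  have hdeg : degFr F ((Fr n).app ⟨A, hA⟩) = n := hpair.isFrobeniusSection.degFr_eq n ⟨A, hA⟩
  have h1n : (1 : ℕ+) = n := hlin.symm.trans (((congrArg (degFr F) hn).symm).trans hdeg)
  subst h1n
  rw [← hn, map_one, End.one_def, NatTrans.id_app]
  rfl

/-! ### Remark 2.7.2, second claim -/

/-- Under the hypotheses of Rmk. 2.7.2 (second claim) every object of `C` lies in `P`: `P → D` is
essentially surjective, so `A_D ≅ Y_D` for some `Y ∈ Ob(P)`; `C` base-trivial gives `A ≅ Y`, and
`C` a skeleton gives `A = Y`. [cite: MochizukiFrdI2008, Rem. 2.7.2 p.52] -/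
theorem obj_of_isBaseSection_of_skeletal (hP : IsBaseSection F P)
    (hbt : IsOfType (IsBaseTrivial F)) (hsk : Skeletal C) (A : C) : P.obj A := by
  haveI := hP.isEquivalence
  let Y : P.Cat := (P.toBase F).objPreimage (baseObj F A)
  have e : baseObj F Y.1 ≅ baseObj F A := (P.toBase F).objObjPreimageIso (baseObj F A)
  obtain ⟨i⟩ := hbt Y.1 A ⟨e⟩
  have hAY : A = Y.1 := hsk ⟨i⟩
  rw [hAY]
  exact Y.2

/-- **Rmk. 2.7.2, second claim, proved**: for `C` of isotropic and base-trivial type, a skeleton,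
with a base-Frobenius pair `(P, F)`, every `φ : A → B` factors UNIQUELY (strictly) as
`φ = α ∘ β ∘ γ` with `γ = F(deg_Fr φ)_A` `F`-distinguished, `β` a base-identity pre-step
endomorphism of `A`, `α ∈ P(A, B)` `P`-distinguished.  Existence: Def. 1.3 (iv)(a) gives
`φ = α' ∘ β' ∘ γ'`; by (ii) `γ' = ε ∘ γ` for an isomorphism `ε`; the linear morphism
`ψ := α' ∘ β' ∘ ε` has `Base(ψ) = Base(α)` for a unique `α ∈ P(A,B)` (`P ⥲ D`), and the pull-back
property of `α` yields the base-identity `β` with `α ∘ β = ψ`.  Uniqueness: degrees force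
`γ₁ = γ`; `γ` is an epimorphism (`C` totally epimorphic); `P → D` faithful forces `α₁ = α`; the
pull-back property of `α` forces `β₁ = β`. [cite: MochizukiFrdI2008, Rem. 2.7.2 p.52] -/
theorem DistinguishedFactorization_holds : DistinguishedFactorization F P Fr := by
  intro hF _hiso hpair hbt hsk A B φ
  have hP := hpair.isBaseSection
  haveI := hP.isEquivalence
  have hA : P.obj A := obj_of_isBaseSection_of_skeletal F P hP hbt hsk A
  have hB : P.obj B := obj_of_isBaseSection_of_skeletal F P hP hbt hsk B
  obtain ⟨n, hn⟩ : ∃ n : ℕ+, degFr F φ = n := ⟨_, rfl⟩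
  set γ : A ⟶ A := (Fr n).app ⟨A, hA⟩ with hγdef
  have hγF : IsFrobeniusType F γ := hpair.isFrobeniusSection.isFrobeniusType n ⟨A, hA⟩
  have hγdeg : degFr F γ = n := hpair.isFrobeniusSection.degFr_eq n ⟨A, hA⟩
  -- Def. 1.3 (iv)(a): `φ = α' ∘ β' ∘ γ'`
  obtain ⟨X, Y, γ', β', α', hfac, hγ', hβ', hα'⟩ := hF.iv_a_exists φ
  have hα'lin : degFr F α' = 1 := (hF.iv_b α' hα').2
  have hβ'lin : degFr F β' = 1 := hβ'.1
  have hγ'deg : degFr F γ' = n := by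
    have h := congrArg (degFr F) hfac
    rw [degFr_comp, degFr_comp, hβ'lin, hα'lin, mul_one, mul_one, hn] at h
    exact h
  -- Def. 1.3 (ii): `γ' = ε ∘ γ`
  obtain ⟨ε, hε⟩ := hF.ii_unique γ γ' hγF hγ' (hγdeg.trans hγ'deg.symm)
  set ψ : A ⟶ B := ε.hom ≫ β' ≫ α' with hψdef
  have hφ : γ ≫ ψ = φ := by rw [hψdef, ← Category.assoc, hε, hfac]
  have hψdeg : degFr F ψ = 1 := by
    rw [hψdef, degFr_comp, degFr_comp, hβ'lin, hα'lin, mul_one, mul_one]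
    exact isLinear_of_isIso F ε.hom
  -- `α ∈ P(A, B)` with `Base(α) = Base(ψ)`
  let A' : P.Cat := ⟨A, hA⟩
  let B' : P.Cat := ⟨B, hB⟩
  let α : A' ⟶ B' := (P.toBase F).preimage (X := A') (Y := B') (Base F ψ)
  have hαbase : Base F α.1 = Base F ψ := (P.toBase F).map_preimage (X := A') (Y := B') (Base F ψ)
  have hαpb : IsPullbackMorphism F α.1 := hP.hom_pullback α.1 α.2
  have hαlin : degFr F α.1 = 1 := (hF.iv_b α.1 hαpb).2
  -- `β` from the pull-back property of `α`
  obtain ⟨β, hβ⟩ := (hαpb A).2 ⟨(ψ, 𝟙 (baseObj F A)), by rw [Category.id_comp, hαbase]⟩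
  have hβ1 : β ≫ α.1 = ψ := congrArg (fun p : PullbackHomData F α.1 A => p.1.1) hβ
  have hβ2 : Base F β = 𝟙 (baseObj F A) := congrArg (fun p : PullbackHomData F α.1 A => p.1.2) hβ
  have hβlin : IsLinear F β := by
    have h := congrArg (degFr F) hβ1
    rw [degFr_comp, hαlin, mul_one, hψdeg] at h
    exact h
  have hβpre : IsPreStep F β := ⟨hβlin, by
    show IsIso (Base F β)
    rw [hβ2]
    infer_instance⟩
  refine ⟨(γ, β, α.1), ⟨?_, ⟨hA, n, rfl⟩, ⟨hβ2, hβpre⟩, α.2⟩, ?_⟩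
  · show γ ≫ β ≫ α.1 = φ
    rw [hβ1, hφ]
  -- uniqueness, "in the strict sense"
  rintro ⟨γ₁, β₁, α₁⟩ ⟨hcomp, ⟨hA₁, n₁, hγ₁⟩, ⟨hβ₁id, hβ₁pre⟩, hα₁⟩
  dsimp only at hcomp hγ₁ hβ₁id hβ₁pre hα₁
  have hβ₁base : Base F β₁ = 𝟙 (baseObj F A) := hβ₁id
  have hβ₁lin : degFr F β₁ = 1 := hβ₁pre.1
  have hα₁lin : degFr F α₁ = 1 := (hF.iv_b α₁ (hP.hom_pullback α₁ hα₁)).2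
  have hn₁ : n₁ = n := by
    have h := congrArg (degFr F) hcomp
    rw [degFr_comp, degFr_comp, hβ₁lin, hα₁lin, mul_one, mul_one] at h
    have h2 : degFr F ((Fr n₁).app ⟨A, hA₁⟩) = n₁ := hpair.isFrobeniusSection.degFr_eq n₁ ⟨A, hA₁⟩
    exact h2.symm.trans ((congrArg (degFr F) hγ₁).trans (h.trans hn))
  subst hn₁
  have hγ₁' : γ₁ = γ := hγ₁.symm
  subst hγ₁'
  haveI : Epi γ := hF.isPreFrobenioid.isTotallyEpimorphic.epi γ
  have key : β₁ ≫ α₁ = β ≫ α.1 := (cancel_epi γ).mp (by rw [hcomp, hβ1, hφ])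
  have hb : Base F α₁ = Base F α.1 := by
    have h := congrArg (Base F) key
    rwa [base_comp, base_comp, hβ₁base, hβ2, Category.id_comp, Category.id_comp] at h
  have hα₁eq : α₁ = α.1 := by
    have h : (⟨α₁, hα₁⟩ : A' ⟶ B') = α :=
      (P.toBase F).map_injective (X := A') (Y := B') hb
    exact congrArg Subtype.val h
  subst hα₁eq
  have hβ₁eq : β₁ = β := by
    apply (hαpb A).1
    apply Subtype.ext
    apply Prod.ext
    · show β₁ ≫ _ = β ≫ _
      rw [key]
    · show Base F β₁ = Base F β
      rw [hβ₁base, hβ2]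
  subst hβ₁eq
  rfl

end PreFrobenioid

end Literature.AlgebraicGeometry.Frobenioids
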